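import Summits.Ventures.Crystal3D.Theorems.StickyWulffConstantPolycrystalWulffBoundChargedCrossWalls

/-!
# `PolycrystalWulffBound`, line `PolyDensity`: the WULFF ROWS of the «top two classes + dust» LP —
# energy split with all cross-class walls, per-class Wulff bounds of the two big classes, and the
# DUST row (sum of the per-class Wulff bounds over every remaining class) — in INTRINSIC form
# (crux `stmt-Ventures-19482`; lane poly-p2, gen 24)

Route `StickyWulffConstant` of the venture `Summits/Ventures/Crystal3D`, second prover lane.  For a
twin-free polyhedral crux texture with generic charge `≥ c₁ ≥ 0` and two grains `f₁, f₂` of different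
lattices — classes `C₁`, `C₂`, rest `R = (C₁ ∪ C₂)ᶜ` (ANY number of further lattices) — with
`Fr f` the free-energy summand of the crux energy, `w f g = ι_{B̄(0,1)}(G f, G g)` the unit-ball
interfaces, `A₁₂, A₁R, A₂R` the block interfaces and `W_RR = Σ_{f,g ∈ R, different lattices} w f g`
(ordered pairs):

* ENERGY SPLIT  `Σ_f Fr f + c₁·(A₁₂ + A₁R + A₂R) + (c₁/2)·W_RR ≤ En`  (`walls_ge_chargedCrossClass`);
* PER-CLASS WULFF  `w(|C₁|) ≤ Σ_{C₁} Fr + √5·(A₁₂ + A₁R)`, `w(|C₂|) ≤ Σ_{C₂} Fr + √5·(A₁₂ + A₂R)`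
  (each class is one body of volume `32`; its walls cost at most the circumradius `√5`);
* DUST  `Σ_{ℓ ⊆ R} w(|C_ℓ|) ≤ Σ_R Fr + √5·(A₁R + A₂R + W_RR)` — the per-class Wulff bounds summed over
  the lattice classes inside `R` (with `Σ_ℓ |C_ℓ| = |R|`; the consumer bounds `Σ_ℓ w(|C_ℓ|)` from
  below by `w·|R|·(max_ℓ |C_ℓ|)^{-1/3}`: small classes are expensive);
* bookkeeping: `Vol = |C₁| + |C₂| + |R|`, `Σ_{C₁∪C₂} Σ_R w = A₁R + A₂R`.

(`w(v) = 6·2^{1/3}(√2 v)^{2/3}`.)  Companion `…TopTwoCutRows`; consumer `…RungTwinFreeAllClassesOne`.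
WHAT THIS IS NOT: a rung by itself; twins; the crux is not claimed.
-/

noncomputable section

open scoped BigOperators InnerProductSpace ENNReal
open MeasureTheory Filter

namespace Summit.Ventures.Crystal3D.Cruxes.PolycrystalWulffBound.PolyDensity

open Summit.Ventures.Crystal3D.Theorems
open Summit.Ventures.Crystal3D.Cruxes.TextureLiminf.TexShadow (per polytope E3 facetArea supportFn)
open Literature.MathematicalPhysics.StatisticalMechanics (perimeter)

set_option maxHeartbeats 800000 in
/-- **Wulff rows of the «top two + dust» LP, intrinsic form** (energy split with all cross-class walls,
per-class Wulff bounds of `C₁`, `C₂`, dust row, bookkeeping).  See the module docstring. -/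
theorem twinFree_topTwo_wulffRows :
    let Λ : Set (EuclideanSpace ℝ (Fin 3)) := Literature.MathematicalPhysics.StatisticalMechanics.fccStacking 1 (Real.sqrt (2 / 3));
    let Brl : (ℤ → ℤ) → Set (EuclideanSpace ℝ (Fin 3)) := Literature.MathematicalPhysics.StatisticalMechanics.barlowStacking 1 (Real.sqrt (2 / 3));
    let Ax : EuclideanSpace ℝ (Fin 3) → (EuclideanSpace ℝ (Fin 3) ≃ₗᵢ[ℝ] EuclideanSpace ℝ (Fin 3)) → (EuclideanSpace ℝ (Fin 3) ≃ₗᵢ[ℝ] EuclideanSpace ℝ (Fin 3)) → Prop := fun m A B => ∃ (L : EuclideanSpace ℝ (Fin 3) ≃ₗᵢ[ℝ] EuclideanSpace ℝ (Fin 3)) (s₁ s₂ : EuclideanSpace ℝ (Fin 3)) (σ σ' : ℤ → ℤ), Literature.MathematicalPhysics.StatisticalMechanics.IsHaggSeq σ ∧ Literature.MathematicalPhysics.StatisticalMechanics.IsHaggSeq σ' ∧ L (EuclideanSpace.single (2 : Fin 3) (1 : ℝ)) = m ∧ A '' Λ ⊆ (fun q => L q + s₁) '' Brl σ ∧ B ''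 Λ ⊆ (fun q => L q + s₂) '' Brl σ';
    let CoAx : (EuclideanSpace ℝ (Fin 3) ≃ₗᵢ[ℝ] EuclideanSpace ℝ (Fin 3)) → (EuclideanSpace ℝ (Fin 3) ≃ₗᵢ[ℝ] EuclideanSpace ℝ (Fin 3)) → Prop := fun A B => ∃ m, Ax m A B;
    let Φ : EuclideanSpace ℝ (Fin 3) → ℝ := fun ν => Real.sqrt 2 / 4 * ∑ᶠ w ∈ {w ∈ Λ | ‖w‖ = 1}, |⟪w, ν⟫_ℝ|;
    let Per : Set (EuclideanSpace ℝ (Fin 3)) → Set (EuclideanSpace ℝ (Fin 3)) → ℝ := fun K S => (⨆ (ξ : EuclideanSpace ℝ (Fin 3) → EuclideanSpace ℝ (Fin 3)) (_ : ContDiff ℝ 1 ξ ∧ HasCompactSupport ξ ∧ ∀ z, ξ z ∈ K), ENNReal.ofReal (∫ z in S, Literature.MathematicalPhysics.StatisticalMechanics.fieldDivergence ξ z)).toReal;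
    let ι : Set (EuclideanSpace ℝ (Fin 3)) → Set (EuclideanSpace ℝ (Fin 3)) → Set (EuclideanSpace ℝ (Fin 3)) → ℝ := fun K S₁ S₂ => (Per K S₁ + Per K S₂ - Per K (S₁ ∪ S₂)) / 2;
    let W : (EuclideanSpace ℝ (Fin 3) ≃ₗᵢ[ℝ] EuclideanSpace ℝ (Fin 3)) → Set (EuclideanSpace ℝ (Fin 3)) := fun A => {y | ∀ ν : EuclideanSpace ℝ (Fin 3), ⟪y, ν⟫_ℝ ≤ Φ (A.symm ν)};
    let Dsc : EuclideanSpace ℝ (Fin 3) → Set (EuclideanSpace ℝ (Fin 3)) := fun m => {y | ‖y‖ ≤ 1 ∧ ⟪y, m⟫_ℝ = 0};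
    let Tex : (n : ℕ) → (Fin n → Set (EuclideanSpace ℝ (Fin 3))) → (Fin n → (EuclideanSpace ℝ (Fin 3) ≃ₗᵢ[ℝ] EuclideanSpace ℝ (Fin 3))) → (Fin n → Fin n → ℝ) → (Fin n → Fin n → EuclideanSpace ℝ (Fin 3)) → Prop := fun n G A c m => (∀ f : Fin n, Literature.MathematicalPhysics.StatisticalMechanics.HasFinitePerimeter (G f) ∧ volume (G f) < ⊤) ∧ (∀ f g, f ≠ g → Disjoint (G f) (G g)) ∧ (∀ f g, f ≠ g → 0 ≤ c f g) ∧ (∀ f g, f ≠ g → ¬ CoAx (A f) (A g) → m f g = 0 ∧ 1 ≤ c f g) ∧ (∀ f g, f ≠ g → CoAx (A f) (A g) → A f '' Λ ≠ A g '' Λ → Ax (m f g) (A f) (A g) ∧ 1 / 2 ≤ c f g);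
    let En : (n : ℕ) → (Fin n → Set (EuclideanSpace ℝ (Fin 3))) → (Fin n → (EuclideanSpace ℝ (Fin 3) ≃ₗᵢ[ℝ] EuclideanSpace ℝ (Fin 3))) → (Fin n → Fin n → ℝ) → (Fin n → Fin n → EuclideanSpace ℝ (Fin 3)) → ℝ := fun n G A c m => ∑ f : Fin n, Per (W (A f)) (G f) - ∑ f, ∑ g, (if f = g then 0 else ι (W (A f)) (G f) (G g)) + ∑ f, ∑ g, (if f = g then 0 else c f g / 2 * ι (Dsc (m f g)) (G f) (G g));
    let Vol : (n : ℕ) → (Fin n → Set (EuclideanSpace ℝ (Fin 3))) → ℝ := fun n G => (volume (⋃ f : Fin n, G f)).toReal;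
    let Poly : Set (EuclideanSpace ℝ (Fin 3)) → Prop := fun S => ∃ (k : ℕ) (H : Fin k → Finset ((EuclideanSpace ℝ (Fin 3)) × ℝ)), S = ⋃ i, ⋂ p ∈ H i, {x | ⟪p.1, x⟫_ℝ < p.2};
    let TF : (n : ℕ) → (Fin n → (EuclideanSpace ℝ (Fin 3) ≃ₗᵢ[ℝ] EuclideanSpace ℝ (Fin 3))) → Prop := fun n A => ∀ f g : Fin n, f ≠ g → CoAx (A f) (A g) → A f '' Λ = A g '' Λ;
    ∀ (c₁ : ℝ) (n : ℕ) (G : Fin n → Set (EuclideanSpace ℝ (Fin 3))) (A : Fin n → (EuclideanSpace ℝ (Fin 3) ≃ₗᵢ[ℝ] EuclideanSpace ℝ (Fin 3))) (c : Fin n → Fin n → ℝ) (m : Fin n → Fin n → EuclideanSpace ℝ (Fin 3)) (f₁ f₂ : Fin n), Tex n G A c m → (∀ f, Poly (G f)) → TF n A → 0 ≤ c₁ → (∀ f g : Fin n, f ≠ g → ¬ CoAx (A f) (A g) → c₁ ≤ c f g) → A f₂ '' Λ ≠ A f₁ '' Λ →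
      ((∑ f, (Per (W (A f)) (G f) - ∑ g, (if f = g then 0 else ι (W (A f)) (G f) (G g)))) +
          c₁ * ((∑ f ∈ Finset.univ.filter (fun f => A f '' Λ = A f₁ '' Λ), ∑ g ∈ Finset.univ.filter (fun f => A f '' Λ = A f₂ '' Λ), (if f = g then 0 else ι (Metric.closedBall (0 : EuclideanSpace ℝ (Fin 3)) 1) (G f) (G g))) +
            (∑ f ∈ Finset.univ.filter (fun f => A f '' Λ = A f₁ '' Λ), ∑ g ∈ (Finset.univ \ (Finset.univ.filter (fun f => A f '' Λ = A f₁ '' Λ) ∪ Finset.univ.filter (fun f => A f '' Λ = A f₂ '' Λ))), (if f = g then 0 else ι (Metric.closedBall (0 : EuclideanSpace ℝ (Fin 3)) 1) (G f) (G g))) +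
            (∑ f ∈ Finset.univ.filter (fun f => A f '' Λ = A f₂ '' Λ), ∑ g ∈ (Finset.univ \ (Finset.univ.filter (fun f => A f '' Λ = A f₁ '' Λ) ∪ Finset.univ.filter (fun f => A f '' Λ = A f₂ '' Λ))), (if f = g then 0 else ι (Metric.closedBall (0 : EuclideanSpace ℝ (Fin 3)) 1) (G f) (G g)))) +
          c₁ / 2 * (∑ f ∈ (Finset.univ \ (Finset.univ.filter (fun f => A f '' Λ = A f₁ '' Λ) ∪ Finset.univ.filter (fun f => A f '' Λ = A f₂ '' Λ))), ∑ g ∈ (Finset.univ \ (Finset.univ.filter (fun f => A f '' Λ = A f₁ '' Λ) ∪ Finset.univ.filter (fun f => A f '' Λ = A f₂ '' Λ))), (if A g '' Λ = A f '' Λ then 0 else (if f = g then 0 else ι (Metric.closedBall (0 : EuclideanSpace ℝ (Fin 3)) 1) (G f) (G g)))) ≤ En n G A c m) ∧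
      (6 * (2 : ℝ) ^ ((1 : ℝ) / 3) * (Real.sqrt 2 * (volume (⋃ f ∈ Finset.univ.filter (fun f => A f '' Λ = A f₁ '' Λ), G f)).toReal) ^ ((2 : ℝ) / 3) ≤
        (∑ f ∈ Finset.univ.filter (fun f => A f '' Λ = A f₁ '' Λ), (Per (W (A f)) (G f) - ∑ g, (if f = g then 0 else ι (W (A f)) (G f) (G g)))) +
          Real.sqrt 5 * ((∑ f ∈ Finset.univ.filter (fun f => A f '' Λ = A f₁ '' Λ), ∑ g ∈ Finset.univ.filter (fun f => A f '' Λ = A f₂ '' Λ), (if f = g then 0 else ι (Metric.closedBall (0 : EuclideanSpace ℝ (Fin 3)) 1) (G f) (G g))) +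
            (∑ f ∈ Finset.univ.filter (fun f => A f '' Λ = A f₁ '' Λ), ∑ g ∈ (Finset.univ \ (Finset.univ.filter (fun f => A f '' Λ = A f₁ '' Λ) ∪ Finset.univ.filter (fun f => A f '' Λ = A f₂ '' Λ))), (if f = g then 0 else ι (Metric.closedBall (0 : EuclideanSpace ℝ (Fin 3)) 1) (G f) (G g))))) ∧
      (6 * (2 : ℝ) ^ ((1 : ℝ) / 3) * (Real.sqrt 2 * (volume (⋃ f ∈ Finset.univ.filter (fun f => A f '' Λ = A f₂ '' Λ), G f)).toReal) ^ ((2 : ℝ) / 3) ≤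
        (∑ f ∈ Finset.univ.filter (fun f => A f '' Λ = A f₂ '' Λ), (Per (W (A f)) (G f) - ∑ g, (if f = g then 0 else ι (W (A f)) (G f) (G g)))) +
          Real.sqrt 5 * ((∑ f ∈ Finset.univ.filter (fun f => A f '' Λ = A f₁ '' Λ), ∑ g ∈ Finset.univ.filter (fun f => A f '' Λ = A f₂ '' Λ), (if f = g then 0 else ι (Metric.closedBall (0 : EuclideanSpace ℝ (Fin 3)) 1) (G f) (G g))) +
            (∑ f ∈ Finset.univ.filter (fun f => A f '' Λ = A f₂ '' Λ), ∑ g ∈ (Finset.univ \ (Finset.univ.filter (fun f => A f '' Λ = A f₁ '' Λ) ∪ Finset.univ.filter (fun f => A f '' Λ = A f₂ '' Λ))), (if f = g then 0 else ι (Metric.closedBall (0 : EuclideanSpace ℝ (Fin 3)) 1) (G f) (G g))))) ∧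
      ((∑ ℓ ∈ (Finset.univ \ (Finset.univ.filter (fun f => A f '' Λ = A f₁ '' Λ) ∪ Finset.univ.filter (fun f => A f '' Λ = A f₂ '' Λ))).image (fun f => A f '' Λ),
          6 * (2 : ℝ) ^ ((1 : ℝ) / 3) * (Real.sqrt 2 * (volume (⋃ f ∈ Finset.univ.filter (fun f => A f '' Λ = ℓ), G f)).toReal) ^ ((2 : ℝ) / 3)) ≤
        (∑ f ∈ (Finset.univ \ (Finset.univ.filter (fun f => A f '' Λ = A f₁ '' Λ) ∪ Finset.univ.filter (fun f => A f '' Λ = A f₂ '' Λ))), (Per (W (A f)) (G f) - ∑ g, (if f = g then 0 else ι (W (A f)) (G f) (G g)))) +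
          Real.sqrt 5 * ((∑ f ∈ Finset.univ.filter (fun f => A f '' Λ = A f₁ '' Λ), ∑ g ∈ (Finset.univ \ (Finset.univ.filter (fun f => A f '' Λ = A f₁ '' Λ) ∪ Finset.univ.filter (fun f => A f '' Λ = A f₂ '' Λ))), (if f = g then 0 else ι (Metric.closedBall (0 : EuclideanSpace ℝ (Fin 3)) 1) (G f) (G g))) +
            (∑ f ∈ Finset.univ.filter (fun f => A f '' Λ = A f₂ '' Λ), ∑ g ∈ (Finset.univ \ (Finset.univ.filter (fun f => A f '' Λ = A f₁ '' Λ) ∪ Finset.univ.filter (fun f => A f '' Λ = A f₂ '' Λ))), (if f = g then 0 else ι (Metric.closedBall (0 : EuclideanSpace ℝ (Fin 3)) 1) (G f) (G g))) +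
            (∑ f ∈ (Finset.univ \ (Finset.univ.filter (fun f => A f '' Λ = A f₁ '' Λ) ∪ Finset.univ.filter (fun f => A f '' Λ = A f₂ '' Λ))), ∑ g ∈ (Finset.univ \ (Finset.univ.filter (fun f => A f '' Λ = A f₁ '' Λ) ∪ Finset.univ.filter (fun f => A f '' Λ = A f₂ '' Λ))), (if A g '' Λ = A f '' Λ then 0 else (if f = g then 0 else ι (Metric.closedBall (0 : EuclideanSpace ℝ (Fin 3)) 1) (G f) (G g)))))) ∧
      ((∑ ℓ ∈ (Finset.univ \ (Finset.univ.filter (fun f => A f '' Λ = A f₁ '' Λ) ∪ Finset.univ.filter (fun f => A f '' Λ = A f₂ '' Λ))).image (fun f => A f '' Λ),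
          (volume (⋃ f ∈ Finset.univ.filter (fun f => A f '' Λ = ℓ), G f)).toReal) = (volume (⋃ f ∈ (Finset.univ \ (Finset.univ.filter (fun f => A f '' Λ = A f₁ '' Λ) ∪ Finset.univ.filter (fun f => A f '' Λ = A f₂ '' Λ))), G f)).toReal) ∧
      (Vol n G = (volume (⋃ f ∈ Finset.univ.filter (fun f => A f '' Λ = A f₁ '' Λ), G f)).toReal + (volume (⋃ f ∈ Finset.univ.filter (fun f => A f '' Λ = A f₂ '' Λ), G f)).toReal + (volume (⋃ f ∈ (Finset.univ \ (Finset.univ.filter (fun f => A f '' Λ = A f₁ '' Λ) ∪ Finset.univ.filter (fun f => A f '' Λ = A f₂ '' Λ))), G f)).toReal) ∧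
      ((∑ f ∈ Finset.univ.filter (fun f => A f '' Λ = A f₁ '' Λ) ∪ Finset.univ.filter (fun f => A f '' Λ = A f₂ '' Λ), ∑ g ∈ (Finset.univ \ (Finset.univ.filter (fun f => A f '' Λ = A f₁ '' Λ) ∪ Finset.univ.filter (fun f => A f '' Λ = A f₂ '' Λ))), (if f = g then 0 else ι (Metric.closedBall (0 : EuclideanSpace ℝ (Fin 3)) 1) (G f) (G g))) =
        (∑ f ∈ Finset.univ.filter (fun f => A f '' Λ = A f₁ '' Λ), ∑ g ∈ (Finset.univ \ (Finset.univ.filter (fun f => A f '' Λ = A f₁ '' Λ) ∪ Finset.univ.filter (fun f => A f '' Λ = A f₂ '' Λ))), (if f = g then 0 else ι (Metric.closedBall (0 : EuclideanSpace ℝ (Fin 3)) 1) (G f) (G g))) + (∑ f ∈ Finset.univ.filter (fun f => A f '' Λ = A f₂ '' Λ), ∑ g ∈ (Finset.univ \ (Finset.univ.filter (fun f => A f '' Λ = A f₁ '' Λ) ∪ Finset.univ.filter (fun f => A f '' Λ = A f₂ '' Λ))), (if f = g then 0 else ι (Metric.closedBall (0 : EuclideanSpace ℝ (Fin 3)) 1)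 (G f) (G g)))) := by
  intro Λ Brl Ax CoAx Φ Per ι W Dsc Tex En Vol Poly TF c₁ n G A c m f₁ f₂ hTex hPoly hTF hc₁ hCh hne
  have eP : ∀ K S, Per K S = per K S := fun _ _ => rfl
  have eι : ∀ K S₁ S₂, ι K S₁ S₂ = (per K S₁ + per K S₂ - per K (S₁ ∪ S₂)) / 2 := fun _ _ _ => rfl
  have hWl : c₁ * (∑ f, ∑ g, (if A g '' Λ = A f '' Λ then 0 else
      (if f = g then 0 else ι (Metric.closedBall (0 : EuclideanSpace ℝ (Fin 3)) 1) (G f) (G g)))) ≤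
      2 * ∑ f, ∑ g, (if f = g then 0 else c f g / 2 * ι (Dsc (m f g)) (G f) (G g)) :=
    walls_ge_chargedCrossClass c₁ n G A c m hTex hPoly hTF hc₁ hCh
  have hEn : En n G A c m = (∑ f, (Per (W (A f)) (G f) - ∑ g, (if f = g then 0 else ι (W (A f)) (G f) (G g)))) +
      ∑ f, ∑ g, (if f = g then 0 else c f g / 2 * ι (Dsc (m f g)) (G f) (G g)) := by
    show (∑ f, Per (W (A f)) (G f) - ∑ f, ∑ g, (if f = g then 0 else ι (W (A f)) (G f) (G g)) +
        ∑ f, ∑ g, (if f = g then 0 else c f g / 2 * ι (Dsc (m f g)) (G f) (G g))) = _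
    rw [Finset.sum_sub_distrib]
  rw [hEn]
  simp only [eι, eP] at hWl ⊢
  classical
  obtain ⟨hfin, hdisj, -, -, -⟩ := id hTex
  have hvol : ∀ f, volume (G f) < ⊤ := fun f => (hfin f).2
  obtain ⟨-, -, -, hVsum⟩ := texture_union_facts G hfin hdisj
  -- lattice classes `C₁ ∋ f₁`, `C₂ ∋ f₂`, the rest `R`
  set lat : Fin n → Set E3 := fun f => A f '' Λ with hlat
  set C₁ : Finset (Fin n) := Finset.univ.filter (fun f => lat f = lat f₁) with hC₁
  set C₂ : Finset (Fin n) := Finset.univ.filter (fun f => lat f = lat f₂) with hC₂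
  set R : Finset (Fin n) := Finset.univ \ (C₁ ∪ C₂) with hR
  have hmem₁ : ∀ f, f ∈ C₁ ↔ lat f = lat f₁ := fun f => by simp [hC₁]
  have hmem₂ : ∀ f, f ∈ C₂ ↔ lat f = lat f₂ := fun f => by simp [hC₂]
  have hne' : lat f₂ ≠ lat f₁ := hne
  have h12 : ∀ f, f ∈ C₁ → f ∉ C₂ := fun f h1 h2 => hne' (((hmem₂ f).1 h2).symm.trans ((hmem₁ f).1 h1))
  have hmemR : ∀ f, f ∈ R ↔ f ∉ C₁ ∧ f ∉ C₂ := fun f => by simp [hR]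
  have hdisj12 : Disjoint C₁ C₂ := Finset.disjoint_left.2 fun f h1 h2 => h12 f h1 h2
  have hdisj1R : Disjoint C₁ R := Finset.disjoint_left.2 fun f h1 hr => ((hmemR f).1 hr).1 h1
  have hdisj2R : Disjoint C₂ R := Finset.disjoint_left.2 fun f h2 hr => ((hmemR f).1 hr).2 h2
  have hR₁ : Finset.univ \ C₁ = C₂ ∪ R := by
    ext f
    simp only [Finset.mem_sdiff, Finset.mem_univ, true_and, Finset.mem_union, hmemR]
    constructor
    · intro hf
      by_cases h2 : f ∈ C₂
      · exact Or.inl h2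
      · exact Or.inr ⟨hf, h2⟩
    · rintro (h2 | ⟨h1, -⟩)
      · exact fun h1 => h12 f h1 h2
      · exact h1
  have hR₂ : Finset.univ \ C₂ = C₁ ∪ R := by
    ext f
    simp only [Finset.mem_sdiff, Finset.mem_univ, true_and, Finset.mem_union, hmemR]
    constructor
    · intro hf
      by_cases h1 : f ∈ C₁
      · exact Or.inl h1
      · exact Or.inr ⟨h1, hf⟩
    · rintro (h1 | ⟨-, h2⟩)
      · exact fun h2 => h12 f h1 h2
      · exact h2
  have hsplitI : ∀ (I : Finset (Fin n)) (F : Fin n → ℝ), (∑ f, F f) = (∑ f ∈ I, F f) + ∑ f ∈ Finset.univ \ I, F f := by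
    intro I F
    rw [← Finset.sum_sdiff (Finset.subset_univ I), add_comm]
  have hsplit3 : ∀ F : Fin n → ℝ, (∑ f, F f) = (∑ f ∈ C₁, F f) + (∑ f ∈ C₂, F f) + ∑ f ∈ R, F f := by
    intro F
    rw [hsplitI (C₁ ∪ C₂), Finset.sum_union hdisj12]
  -- bodies
  have hBallc : ∀ r : ℝ, IsCompact (Metric.closedBall (0 : E3) r) := fun r => isCompact_closedBall 0 r
  have hBallv : ∀ r : ℝ, Convex ℝ (Metric.closedBall (0 : E3) r) := fun r => convex_closedBall 0 r
  have hBall0 : ∀ {r : ℝ}, 0 ≤ r → (0 : E3) ∈ Metric.closedBall (0 : E3) r := fun hr =>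
    Metric.mem_closedBall_self hr
  have hBalls : ∀ r : ℝ, -Metric.closedBall (0 : E3) r = Metric.closedBall 0 r := fun r => by
    rw [neg_closedBall, neg_zero]
  have hBc := hBallc 1; have hBv := hBallv 1; have hBs := hBalls 1
  have hB0 : (0 : E3) ∈ Metric.closedBall (0 : E3) 1 := hBall0 zero_le_one
  have h50 : (0 : ℝ) ≤ Real.sqrt 5 := Real.sqrt_nonneg 5
  have h5pos : (0 : ℝ) < Real.sqrt 5 := by positivity
  have hWc : ∀ f, IsCompact (W (A f)) := fun f => isCompact_cruxWulffBody (A f)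
  have hWv : ∀ f, Convex ℝ (W (A f)) := fun f => convex_cruxWulffBody (A f)
  have hW0 : ∀ f, (0 : E3) ∈ W (A f) := fun f => zero_mem_cruxWulffBody (A f)
  have hWs : ∀ f, -W (A f) = W (A f) := fun f => neg_cruxWulffBody_eq (A f)
  have hW5 : ∀ f, W (A f) ⊆ Metric.closedBall (0 : E3) (Real.sqrt 5) := fun f =>
    cruxWulffBody_subset_closedBall (A f)
  have hWeq : ∀ f g, lat f = lat g → W (A f) = W (A g) := fun f g h => wulffBody_eq_of_image_eq h
  have hperBr : ∀ {r : ℝ}, 0 < r → ∀ S : Set E3, per (Metric.closedBall (0 : E3) r) S =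
      r * per (Metric.closedBall (0 : E3) 1) S := by
    intro r hr S
    rw [per_closedBall_eq_mul_perimeter hr, per_closedBall_eq_mul_perimeter one_pos, one_mul]
  -- common refinement (walls clause only)
  obtain ⟨k, H, ν, S, SX, hcross, -, -⟩ := exists_exterior_crossSums G hPoly hvol hdisj
  -- the unit-ball interface terms `w`
  set w : Fin n → Fin n → ℝ := fun f g => if f = g then 0 else
    (per (Metric.closedBall (0 : E3) 1) (G f) + per (Metric.closedBall (0 : E3) 1) (G g) -
      per (Metric.closedBall (0 : E3) 1) (G f ∪ G g)) / 2 with hw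
  have hw0 : ∀ f g, 0 ≤ w f g := by
    intro f g
    by_cases hfg : f = g
    · simp only [hw, hfg, if_true]; exact le_rfl
    · simp only [hw, hfg, if_false]
      exact div_nonneg (iota_nonneg_of_poly G hPoly hvol hdisj hBc hBv hB0 hfg) zero_le_two
  have hwsymm : ∀ f g, w f g = w g f := fun f g => iota_kernel_symm _ G f g
  have hwswap : ∀ I J : Finset (Fin n), (∑ f ∈ I, ∑ g ∈ J, w f g) = ∑ f ∈ J, ∑ g ∈ I, w f g := by
    intro I J
    rw [Finset.sum_comm]
    exact Finset.sum_congr rfl fun f _ => Finset.sum_congr rfl fun g _ => hwsymm g f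
  -- interfaces with a Wulff body cost at most `√5 ×` the unit-ball interface
  have hιW_le : ∀ f g, f ≠ g →
      per (W (A f)) (G f) + per (W (A f)) (G g) - per (W (A f)) (G f ∪ G g) ≤
        Real.sqrt 5 * (per (Metric.closedBall (0 : E3) 1) (G f) +
          per (Metric.closedBall (0 : E3) 1) (G g) - per (Metric.closedBall (0 : E3) 1) (G f ∪ G g)) := by
    intro f g hfg
    have h1 := hcross (W (A f)) (hWc f) (hWv f) (hW0 f) f g hfg
    have h2 := hcross (Metric.closedBall (0 : E3) (Real.sqrt 5)) (hBallc _) (hBallv _) (hBall0 h50) f g hfg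
    have hmono' := crossSum_mono (hW5 f) Metric.isBounded_closedBall ⟨0, hW0 f⟩ H ν (S f) (S g)
    rw [← h1, ← h2, hperBr h5pos, hperBr h5pos, hperBr h5pos] at hmono'
    linarith
  -- PER-CLASS WULFF BOUND for the class of any grain `fc`
  have hclass : ∀ fc : Fin n,
      6 * (2 : ℝ) ^ ((1 : ℝ) / 3) * (Real.sqrt 2 *
        (volume (⋃ f ∈ Finset.univ.filter (fun f => lat f = lat fc), G f)).toReal) ^ ((2 : ℝ) / 3) -
        Real.sqrt 5 * (∑ f ∈ Finset.univ.filter (fun f => lat f = lat fc),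
          ∑ g ∈ Finset.univ \ Finset.univ.filter (fun f => lat f = lat fc), w f g) ≤
      ∑ f ∈ Finset.univ.filter (fun f => lat f = lat fc), (per (W (A f)) (G f) - ∑ g, (if f = g then 0 else
          (per (W (A f)) (G f) + per (W (A f)) (G g) - per (W (A f)) (G f ∪ G g)) / 2)) := by
    intro fc
    set D : Finset (Fin n) := Finset.univ.filter (fun f => lat f = lat fc) with hD
    have hmemD : ∀ f, f ∈ D ↔ lat f = lat fc := fun f => by simp [hD]
    set K₀ : Set E3 := W (A fc) with hK₀
    have hKD : ∀ f ∈ D, W (A f) = K₀ := fun f hf => hWeq f fc ((hmemD f).1 hf)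
    have hfactsD := subfamily_union_facts G hfin hdisj D
    have hX' : (∑ f ∈ D, (per (W (A f)) (G f) - ∑ g, (if f = g then 0 else
          (per (W (A f)) (G f) + per (W (A f)) (G g) - per (W (A f)) (G f ∪ G g)) / 2))) =
        ∑ f ∈ D, (per K₀ (G f) - ∑ g, (if f = g then 0 else
            (per K₀ (G f) + per K₀ (G g) - per K₀ (G f ∪ G g)) / 2)) :=
      Finset.sum_congr rfl fun f hf => by rw [hKD f hf]
    rw [hX', freeEnergy_class_eq_merged G hPoly hvol hdisj (hWc fc) (hWv fc) (hW0 fc) (hWs fc) _]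
    have hWulff : 6 * (2 : ℝ) ^ ((1 : ℝ) / 3) * (Real.sqrt 2 * (volume (⋃ f ∈ D, G f)).toReal) ^ ((2 : ℝ) / 3) ≤
        per K₀ (⋃ f ∈ D, G f) :=
      polycrystalWulffBound_singleGrain (A fc) ⟨hfactsD.1, lt_top_iff_ne_top.2 hfactsD.2.2.1⟩ hfactsD.2.1
    have hover : (∑ g ∈ Finset.univ \ D,
        (per K₀ (⋃ f ∈ D, G f) + per K₀ (G g) - per K₀ ((⋃ f ∈ D, G f) ∪ G g)) / 2) ≤
        Real.sqrt 5 * ∑ f ∈ D, ∑ g ∈ Finset.univ \ D, w f g := by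
      have hadd : ∀ g ∈ Finset.univ \ D,
          (per K₀ (⋃ f ∈ D, G f) + per K₀ (G g) - per K₀ ((⋃ f ∈ D, G f) ∪ G g)) / 2 ≤
          Real.sqrt 5 * ∑ f ∈ D, w f g := by
        intro g hg
        have hg' : g ∉ D := (Finset.mem_sdiff.1 hg).2
        rw [two_iota_biUnion_left G hPoly hvol hdisj (hWc fc) (hWv fc) (hW0 fc) (hWs fc) hg',
          Finset.sum_div, Finset.mul_sum]
        refine Finset.sum_le_sum fun f hf => ?_
        have hfg : f ≠ g := fun h => hg' (h ▸ hf)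
        have hle := hιW_le f g hfg
        rw [hKD f hf] at hle
        simp only [hw, hfg, if_false]
        nlinarith
      refine (Finset.sum_le_sum hadd).trans (le_of_eq ?_)
      rw [← Finset.mul_sum, Finset.sum_comm]
    linarith
  -- per class: the outer interface of a class splits over the other blocks
  have hout₁ : (∑ f ∈ C₁, ∑ g ∈ Finset.univ \ C₁, w f g) =
      (∑ f ∈ C₁, ∑ g ∈ C₂, w f g) + ∑ f ∈ C₁, ∑ g ∈ R, w f g := by
    rw [← Finset.sum_add_distrib]
    exact Finset.sum_congr rfl fun f _ => by rw [hR₁, Finset.sum_union hdisj2R]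
  have hout₂ : (∑ f ∈ C₂, ∑ g ∈ Finset.univ \ C₂, w f g) =
      (∑ f ∈ C₁, ∑ g ∈ C₂, w f g) + ∑ f ∈ C₂, ∑ g ∈ R, w f g := by
    rw [hwswap C₁ C₂, ← Finset.sum_add_distrib]
    exact Finset.sum_congr rfl fun f _ => by rw [hR₂, Finset.sum_union hdisj1R]
  have hβ₁ := hclass f₁
  have hβ₂ := hclass f₂
  rw [hout₁] at hβ₁
  rw [hout₂] at hβ₂
  -- for a grain of `R`, the different-lattice interfaces split over `C₁`, `C₂` and `R`
  have hRrow : ∀ f ∈ R, (∑ g, (if lat g = lat f then 0 else w f g)) =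
      (∑ g ∈ C₁, w f g) + (∑ g ∈ C₂, w f g) + ∑ g ∈ R, (if lat g = lat f then 0 else w f g) := by
    intro f hf
    obtain ⟨hf1, hf2⟩ := (hmemR f).1 hf
    rw [hsplit3]
    congr 1
    congr 1
    · refine Finset.sum_congr rfl fun g hg => ?_
      rw [if_neg (fun h => hf1 ((hmem₁ f).2 (h.symm.trans ((hmem₁ g).1 hg))))]
    · refine Finset.sum_congr rfl fun g hg => ?_
      rw [if_neg (fun h => hf2 ((hmem₂ f).2 (h.symm.trans ((hmem₂ g).1 hg))))]
  -- a class interface in `if` form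
  have hifD : ∀ fc f : Fin n, lat f = lat fc → (∑ g ∈ Finset.univ \ Finset.univ.filter (fun g => lat g = lat fc), w f g) =
      ∑ g, (if lat g = lat f then 0 else w f g) := by
    intro fc f hffc
    have hDc_eq : Finset.univ \ Finset.univ.filter (fun g => lat g = lat fc) =
        Finset.univ.filter (fun g => ¬ lat g = lat fc) := by
      ext g; simp
    rw [hDc_eq, Finset.sum_filter, hffc]
    refine Finset.sum_congr rfl fun g _ => ?_
    by_cases h : lat g = lat fc
    · rw [if_neg (not_not.2 h), if_pos h]
    · rw [if_pos h, if_neg h]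
  -- ENERGY SPLIT: the total cross-class interface in block form
  have htot : (∑ f, ∑ g, (if lat g = lat f then 0 else w f g)) =
      2 * (∑ f ∈ C₁, ∑ g ∈ C₂, w f g) + 2 * (∑ f ∈ C₁, ∑ g ∈ R, w f g) + 2 * (∑ f ∈ C₂, ∑ g ∈ R, w f g) +
        ∑ f ∈ R, ∑ g ∈ R, (if lat g = lat f then 0 else w f g) := by
    rw [hsplit3]
    have e1 : (∑ f ∈ C₁, ∑ g, (if lat g = lat f then 0 else w f g)) =
        (∑ f ∈ C₁, ∑ g ∈ C₂, w f g) + ∑ f ∈ C₁, ∑ g ∈ R, w f g := by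
      rw [← hout₁]
      exact Finset.sum_congr rfl fun f hf => by rw [← hifD f₁ f ((hmem₁ f).1 hf)]
    have e2 : (∑ f ∈ C₂, ∑ g, (if lat g = lat f then 0 else w f g)) =
        (∑ f ∈ C₁, ∑ g ∈ C₂, w f g) + ∑ f ∈ C₂, ∑ g ∈ R, w f g := by
      rw [← hout₂]
      exact Finset.sum_congr rfl fun f hf => by rw [← hifD f₂ f ((hmem₂ f).1 hf)]
    have e3 : (∑ f ∈ R, ∑ g, (if lat g = lat f then 0 else w f g)) =
        (∑ f ∈ C₁, ∑ g ∈ R, w f g) + (∑ f ∈ C₂, ∑ g ∈ R, w f g) +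
          ∑ f ∈ R, ∑ g ∈ R, (if lat g = lat f then 0 else w f g) := by
      rw [hwswap C₁ R, hwswap C₂ R, ← Finset.sum_add_distrib, ← Finset.sum_add_distrib]
      exact Finset.sum_congr rfl fun f hf => hRrow f hf
    rw [e1, e2, e3]
    ring
  have hα : (∑ f, (per (W (A f)) (G f) - ∑ g, (if f = g then 0 else
        (per (W (A f)) (G f) + per (W (A f)) (G g) - per (W (A f)) (G f ∪ G g)) / 2))) +
      c₁ * ((∑ f ∈ C₁, ∑ g ∈ C₂, w f g) + (∑ f ∈ C₁, ∑ g ∈ R, w f g) + ∑ f ∈ C₂, ∑ g ∈ R, w f g) +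
      c₁ / 2 * (∑ f ∈ R, ∑ g ∈ R, (if lat g = lat f then 0 else w f g)) ≤
      (∑ f, (per (W (A f)) (G f) - ∑ g, (if f = g then 0 else
        (per (W (A f)) (G f) + per (W (A f)) (G g) - per (W (A f)) (G f ∪ G g)) / 2))) +
      ∑ f, ∑ g, (if f = g then 0 else c f g / 2 * ((per (Dsc (m f g)) (G f) + per (Dsc (m f g)) (G g) -
        per (Dsc (m f g)) (G f ∪ G g)) / 2)) := by
    have hWl' : c₁ * (∑ f, ∑ g, (if lat g = lat f then 0 else w f g)) ≤
        2 * ∑ f, ∑ g, (if f = g then 0 else c f g / 2 * ((per (Dsc (m f g)) (G f) + per (Dsc (m f g)) (G g) -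
          per (Dsc (m f g)) (G f ∪ G g)) / 2)) := hWl
    rw [htot] at hWl'
    nlinarith
  -- DUST: the per-class bounds summed over the lattice classes inside `R`
  set LR : Finset (Set E3) := R.image lat with hLR
  have hfib : ∀ ℓ ∈ LR, Finset.univ.filter (fun f => lat f = ℓ) = R.filter (fun f => lat f = ℓ) := by
    intro ℓ hℓ
    obtain ⟨g, hgR, hgl⟩ := Finset.mem_image.1 hℓ
    obtain ⟨hg1, hg2⟩ := (hmemR g).1 hgR
    ext f
    simp only [Finset.mem_filter, Finset.mem_univ, true_and, hmemR]
    constructor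
    · intro hf
      refine ⟨⟨fun h1 => hg1 ((hmem₁ g).2 (hgl.trans (hf.symm.trans ((hmem₁ f).1 h1)))),
        fun h2 => hg2 ((hmem₂ g).2 (hgl.trans (hf.symm.trans ((hmem₂ f).1 h2))))⟩, hf⟩
    · exact fun h => h.2
  have hfiber : ∀ F : Fin n → ℝ, (∑ ℓ ∈ LR, ∑ f ∈ Finset.univ.filter (fun f => lat f = ℓ), F f) = ∑ f ∈ R, F f := by
    intro F
    rw [Finset.sum_congr rfl fun ℓ hℓ => by rw [hfib ℓ hℓ]]
    exact Finset.sum_fiberwise_of_maps_to (fun f hf => Finset.mem_image_of_mem lat hf) F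
  have hβR : (∑ ℓ ∈ LR, 6 * (2 : ℝ) ^ ((1 : ℝ) / 3) * (Real.sqrt 2 *
        (volume (⋃ f ∈ Finset.univ.filter (fun f => lat f = ℓ), G f)).toReal) ^ ((2 : ℝ) / 3)) ≤
      (∑ f ∈ R, (per (W (A f)) (G f) - ∑ g, (if f = g then 0 else
          (per (W (A f)) (G f) + per (W (A f)) (G g) - per (W (A f)) (G f ∪ G g)) / 2))) +
        Real.sqrt 5 * ((∑ f ∈ C₁, ∑ g ∈ R, w f g) + (∑ f ∈ C₂, ∑ g ∈ R, w f g) +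
          ∑ f ∈ R, ∑ g ∈ R, (if lat g = lat f then 0 else w f g)) := by
    have hsum : (∑ ℓ ∈ LR, 6 * (2 : ℝ) ^ ((1 : ℝ) / 3) * (Real.sqrt 2 *
        (volume (⋃ f ∈ Finset.univ.filter (fun f => lat f = ℓ), G f)).toReal) ^ ((2 : ℝ) / 3)) ≤
        ∑ ℓ ∈ LR, ((∑ f ∈ Finset.univ.filter (fun f => lat f = ℓ), (per (W (A f)) (G f) - ∑ g, (if f = g then 0 else
          (per (W (A f)) (G f) + per (W (A f)) (G g) - per (W (A f)) (G f ∪ G g)) / 2))) +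
          Real.sqrt 5 * ∑ f ∈ Finset.univ.filter (fun f => lat f = ℓ), ∑ g, (if lat g = lat f then 0 else w f g)) := by
      refine Finset.sum_le_sum fun ℓ hℓ => ?_
      obtain ⟨fc, -, rfl⟩ := Finset.mem_image.1 hℓ
      have h := hclass fc
      have e : (∑ f ∈ Finset.univ.filter (fun f => lat f = lat fc),
          ∑ g ∈ Finset.univ \ Finset.univ.filter (fun f => lat f = lat fc), w f g) =
          ∑ f ∈ Finset.univ.filter (fun f => lat f = lat fc), ∑ g, (if lat g = lat f then 0 else w f g) :=
        Finset.sum_congr rfl fun f hf => hifD fc f (Finset.mem_filter.1 hf).2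
      rw [e] at h
      linarith
    refine hsum.trans (le_of_eq ?_)
    have e1 : (∑ ℓ ∈ LR, ∑ f ∈ Finset.univ.filter (fun f => lat f = ℓ), (per (W (A f)) (G f) - ∑ g, (if f = g then 0 else
          (per (W (A f)) (G f) + per (W (A f)) (G g) - per (W (A f)) (G f ∪ G g)) / 2))) =
        ∑ f ∈ R, (per (W (A f)) (G f) - ∑ g, (if f = g then 0 else
          (per (W (A f)) (G f) + per (W (A f)) (G g) - per (W (A f)) (G f ∪ G g)) / 2)) := hfiber _
    have e2 : (∑ ℓ ∈ LR, ∑ f ∈ Finset.univ.filter (fun f => lat f = ℓ), ∑ g, (if lat g = lat f then 0 else w f g)) =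
        ∑ f ∈ R, ∑ g, (if lat g = lat f then 0 else w f g) := hfiber _
    rw [Finset.sum_add_distrib, ← Finset.mul_sum, e1, e2, hwswap C₁ R, hwswap C₂ R,
      ← Finset.sum_add_distrib, ← Finset.sum_add_distrib]
    congr 1
    congr 1
    exact Finset.sum_congr rfl fun f hf => hRrow f hf
  -- volumes
  have hvolI : ∀ I : Finset (Fin n), (volume (⋃ f ∈ I, G f)).toReal = ∑ f ∈ I, (volume (G f)).toReal :=
    fun I => (subfamily_union_facts G hfin hdisj I).2.2.2
  have hVR : (∑ ℓ ∈ LR, (volume (⋃ f ∈ Finset.univ.filter (fun f => lat f = ℓ), G f)).toReal) =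
      (volume (⋃ f ∈ R, G f)).toReal := by
    rw [hvolI R, Finset.sum_congr rfl fun ℓ _ => hvolI _]
    exact hfiber _
  have hVol : Vol n G = (volume (⋃ f ∈ C₁, G f)).toReal + (volume (⋃ f ∈ C₂, G f)).toReal +
      (volume (⋃ f ∈ R, G f)).toReal := by
    show (volume (⋃ f, G f)).toReal = _
    rw [hVsum, hvolI, hvolI, hvolI]
    exact hsplit3 _
  have hU : (∑ f ∈ C₁ ∪ C₂, ∑ g ∈ R, w f g) = (∑ f ∈ C₁, ∑ g ∈ R, w f g) + ∑ f ∈ C₂, ∑ g ∈ R, w f g :=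
    Finset.sum_union hdisj12
  refine ⟨hα, by linarith [hβ₁], by linarith [hβ₂], hβR, hVR, hVol, hU⟩

end Summit.Ventures.Crystal3D.Cruxes.PolycrystalWulffBound.PolyDensity

end
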